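import Mathlib
import HarnessLib
import Summits.Ventures.LatticeQCDFlow.Exactness.IMHKernel
import Summits.Ventures.LatticeQCDFlow.Exactness.NCMCGeneralSpaceRelativeEntropy

/-!
# Path-IMH against the one-way switch on a general state space: the acceptance window `[2a − 1, a]`

HONEST FRAMING: exact (Metropolis-corrected) sampling algorithms for lattice gauge theory;
figures of merit are autocorrelation/cost numbers at stated couplings and volumes; no
continuum-physics claim.

Venture `LatticeQCDFlow` (cell pub-lqcd), topic `Exactness`; FANOUT row 13 (`eng-snf`, GEN-10).
NEW WORK of the cell (general measure theory, elementary), not a published result; nothing is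
cited as a fact.  General-state-space counterpart of row 8's finite
`Exactness/NCMCAcceptance.accRate_path_le_ncmcAccRate` /
`two_mul_ncmcAccRate_sub_one_le_accRate_path` (theory-2's T2-E / T2-X on finite path spaces): the
two exact Metropolizations of ONE protocol certified as a Crooks pair (`NCMCGeneralSpace.lean`) —
the expanded-ensemble switch at `c = ΔF` (`NCMCGeneralSpaceKernel.lean`) and path-IMH
(`NCMCGeneralSpacePathIMH.lean`, row 30's `indepMH` on records with proposal `P_F` and weight
`e^{−W}`) — compared by their stationary mean acceptances.

## Content (`P_F`, `P_R` the normalised record laws, `d = dP_R/dP_F = e^{ΔF − W}`)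

* `CrooksPair.imhAcceptance_eq` — the STATIONARY mean acceptance of path-IMH (current record
  distributed by its invariant probability law, which as a law on records is `P_R` —
  `NCMCGeneralSpacePathIMH.pathIMH_invariant`, normalised: row 8's
  `Scoring/PathIMHAutocorrelation.pathIMH_invariant_revLaw` — fresh proposal from `P_F`, row 30's
  `imhAcceptMass`; the IMH acceptance only sees work differences, cf. row 2's
  `imhAccept_const_mul`) is the symmetric overlap `∬ min(d(ω), d(ω')) dP_F(ω) dP_F(ω')`;
* the switch's mean acceptance at `c = ΔF` is `∫ min(1, d) dP_F` (`lintegral_accF_eq_min_density`);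
* **`CrooksPair.imhAcceptance_le_switchAcceptance`** — `a_IMH ≤ a_NCMC`: comparing the fresh
  evolution with the previous one accepts at most as often as comparing it with the reverse
  ensemble (`∫ min(d, d') dP_F ≤ min(1, d')`);
* **`CrooksPair.two_mul_switchAcceptance_le`** — `2 a_NCMC ≤ a_IMH + 1`, i.e. `a_IMH ≥ 2 a_NCMC − 1`
  (`min(d,1) + min(d',1) ≤ min(d,d') + 1` pointwise): the window `[2a − 1, a]`.

Everything in `ℝ≥0∞` (no integrability side conditions); any Crooks pair; nothing about values.
-/

namespace Summit.Ventures.LatticeQCDFlow.Exactness.GeneralNCMC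

open MeasureTheory ProbabilityTheory Set Filter
open scoped ENNReal

variable {Ω E : Type*} [MeasurableSpace Ω] [MeasurableSpace E]

omit [MeasurableSpace E] in
/-- Pointwise: `d(x) · min(1, d(y)/d(x)) = min(d(x), d(y))` for `d = e^{ΔF − W}`, in `ℝ≥0∞`. -/
theorem density_mul_imhAcceptE (W : E → ℝ) (ΔF : ℝ) (x y : E) :
    ENNReal.ofReal (Real.exp (ΔF - W x)) * imhAcceptE (fun ε => Real.exp (-W ε)) x y =
      min (ENNReal.ofReal (Real.exp (ΔF - W x))) (ENNReal.ofReal (Real.exp (ΔF - W y))) := by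
  unfold imhAcceptE imhAccept
  rw [← ENNReal.ofReal_mul (Real.exp_pos _).le, mul_min_of_nonneg _ _ (Real.exp_pos _).le, mul_one,
    ← Real.exp_sub, ← Real.exp_add, show ΔF - W x + (-W y - -W x) = ΔF - W y by ring,
    ENNReal.ofReal_min]

omit [MeasurableSpace E] in
/-- Pointwise window inequality: `min(a, 1) + min(b, 1) ≤ min(a, b) + 1` in `ℝ≥0∞`. -/
theorem min_one_add_min_one_le (a b : ℝ≥0∞) : min a 1 + min b 1 ≤ min a b + 1 := by
  rcases le_total a b with hab | hab
  · have h1 : min a 1 ≤ min a b := by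
      rw [min_eq_left hab]
      exact min_le_left _ _
    calc min a 1 + min b 1 ≤ min a 1 + 1 := add_le_add le_rfl (min_le_right _ _)
      _ ≤ min a b + 1 := add_le_add h1 le_rfl
  · have h1 : min b 1 ≤ min a b := by
      rw [min_eq_right hab]
      exact min_le_left _ _
    calc min a 1 + min b 1 ≤ 1 + min b 1 := add_le_add (min_le_right _ _) le_rfl
      _ = min b 1 + 1 := add_comm _ _
      _ ≤ min a b + 1 := add_le_add h1 le_rfl

namespace CrooksPair

variable {ν₀ ν₁ : Measure Ω} {κF κR : Kernel Ω E} {s e : E → Ω} {W : E → ℝ}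

/-- **The switch acceptance as an overlap integral**: `∫ min(1, e^{−(W−ΔF)}) dP_F = ∫ min(1, d) dP_F`
with `d = e^{ΔF − W}` (definitional bookkeeping). -/
theorem lintegral_accF_eq_min_density (ΔF : ℝ) (W : E → ℝ) (μ : Measure E) :
    ∫⁻ ε, accF ΔF W ε ∂μ = ∫⁻ ε, min 1 (ENNReal.ofReal (Real.exp (ΔF - W ε))) ∂μ := by
  refine lintegral_congr fun ε => ?_
  rw [accF, ENNReal.ofReal_min, ENNReal.ofReal_one, show -(W ε - ΔF) = ΔF - W ε by ring]

/-- **The stationary path-IMH acceptance is the symmetric overlap `∬ min(d, d') dP_F dP_F`.**  The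
current record is distributed by `P_R` (the invariant law of path-IMH read on records), the proposal
by `P_F`; `d = dP_R/dP_F = e^{ΔF − W}`. -/
theorem imhAcceptance_eq [IsFiniteMeasure ν₀] [IsFiniteMeasure ν₁] [IsMarkovKernel κF]
    [IsMarkovKernel κR] (h0 : ν₀ univ ≠ 0) (h1 : ν₁ univ ≠ 0) (h : CrooksPair ν₀ ν₁ κF κR s e W)
    {ΔF : ℝ} (hΔF : Real.exp (-ΔF) = ((ν₀ univ)⁻¹ * ν₁ univ).toReal) :
    ∫⁻ x, imhAcceptMass (fwdPathLaw ν₀ κF) (fun ε => Real.exp (-W ε)) x ∂(fwdPathLaw ν₁ κR) =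
      ∫⁻ x, ∫⁻ y, min (ENNReal.ofReal (Real.exp (ΔF - W x))) (ENNReal.ofReal (Real.exp (ΔF - W y)))
        ∂(fwdPathLaw ν₀ κF) ∂(fwdPathLaw ν₀ κF) := by
  haveI := isProbabilityMeasure_fwdPathLaw ν₀ h0 κF
  have hd : Measurable fun ε => ENNReal.ofReal (Real.exp (ΔF - W ε)) :=
    (Real.measurable_exp.comp (measurable_const.sub h.measurable_W)).ennreal_ofReal
  have hw : Measurable fun ε => Real.exp (-W ε) := Real.measurable_exp.comp h.measurable_W.neg
  have hmass : Measurable (imhAcceptMass (fwdPathLaw ν₀ κF) fun ε => Real.exp (-W ε)) :=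
    measurable_imhAcceptMass _ hw
  rw [h.revPathLaw_eq_withDensity h0 h1 hΔF, lintegral_withDensity_eq_lintegral_mul _ hd hmass]
  refine lintegral_congr fun x => ?_
  have hmx : Measurable fun y => imhAcceptE (fun ε => Real.exp (-W ε)) x y :=
    (measurable_imhAcceptE hw).comp measurable_prodMk_left
  rw [Pi.mul_apply, imhAcceptMass, ← lintegral_const_mul _ hmx]
  exact lintegral_congr fun y => density_mul_imhAcceptE W ΔF x y

/-- **Path-IMH accepts at most as often as the one-way switch**: `a_IMH ≤ a_NCMC`, i.e.
`∬ min(d, d') dP_F dP_F ≤ ∫ min(1, d') dP_F` — for every Crooks pair on a general state space. -/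
theorem imhAcceptance_le_switchAcceptance [IsFiniteMeasure ν₀] [IsFiniteMeasure ν₁]
    [IsMarkovKernel κF] [IsMarkovKernel κR] (h0 : ν₀ univ ≠ 0) (h1 : ν₁ univ ≠ 0)
    (h : CrooksPair ν₀ ν₁ κF κR s e W) {ΔF : ℝ}
    (hΔF : Real.exp (-ΔF) = ((ν₀ univ)⁻¹ * ν₁ univ).toReal) :
    ∫⁻ x, imhAcceptMass (fwdPathLaw ν₀ κF) (fun ε => Real.exp (-W ε)) x ∂(fwdPathLaw ν₁ κR) ≤
      ∫⁻ ε, accF ΔF W ε ∂(fwdPathLaw ν₀ κF) := by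
  haveI := isProbabilityMeasure_fwdPathLaw ν₀ h0 κF
  have hd : Measurable fun ε => ENNReal.ofReal (Real.exp (ΔF - W ε)) :=
    (Real.measurable_exp.comp (measurable_const.sub h.measurable_W)).ennreal_ofReal
  -- the density integrates to one against `P_F`
  have hd1 : ∫⁻ ε, ENNReal.ofReal (Real.exp (ΔF - W ε)) ∂(fwdPathLaw ν₀ κF) = 1 := by
    haveI := isProbabilityMeasure_fwdPathLaw ν₁ h1 κR
    have huniv : ((fwdPathLaw ν₀ κF).withDensity fun ε => ENNReal.ofReal (Real.exp (ΔF - W ε))) univ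
        = 1 := by rw [← h.revPathLaw_eq_withDensity h0 h1 hΔF, measure_univ]
    rwa [withDensity_apply _ MeasurableSet.univ, Measure.restrict_univ] at huniv
  rw [h.imhAcceptance_eq h0 h1 hΔF,
    lintegral_lintegral_swap ((hd.comp measurable_fst).min (hd.comp measurable_snd)).aemeasurable,
    lintegral_accF_eq_min_density]
  refine lintegral_mono fun y => le_min ?_ ?_
  · calc ∫⁻ x, min (ENNReal.ofReal (Real.exp (ΔF - W x))) (ENNReal.ofReal (Real.exp (ΔF - W y)))
          ∂(fwdPathLaw ν₀ κF)
        ≤ ∫⁻ x, ENNReal.ofReal (Real.exp (ΔF - W x)) ∂(fwdPathLaw ν₀ κF) :=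
          lintegral_mono fun x => min_le_left _ _
      _ = 1 := hd1
  · calc ∫⁻ x, min (ENNReal.ofReal (Real.exp (ΔF - W x))) (ENNReal.ofReal (Real.exp (ΔF - W y)))
          ∂(fwdPathLaw ν₀ κF)
        ≤ ∫⁻ _, ENNReal.ofReal (Real.exp (ΔF - W y)) ∂(fwdPathLaw ν₀ κF) :=
          lintegral_mono fun x => min_le_right _ _
      _ = ENNReal.ofReal (Real.exp (ΔF - W y)) := by rw [lintegral_const, measure_univ, mul_one]

/-- **… and at least `2 a_NCMC − 1`**: `2 · ∫ min(1, d) dP_F ≤ ∬ min(d, d') dP_F dP_F + 1` — the two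
exact Metropolizations of one protocol sit in the acceptance window `[2a − 1, a]`. -/
theorem two_mul_switchAcceptance_le [IsFiniteMeasure ν₀] [IsFiniteMeasure ν₁]
    [IsMarkovKernel κF] [IsMarkovKernel κR] (h0 : ν₀ univ ≠ 0) (h1 : ν₁ univ ≠ 0)
    (h : CrooksPair ν₀ ν₁ κF κR s e W) {ΔF : ℝ}
    (hΔF : Real.exp (-ΔF) = ((ν₀ univ)⁻¹ * ν₁ univ).toReal) :
    2 * ∫⁻ ε, accF ΔF W ε ∂(fwdPathLaw ν₀ κF) ≤
      ∫⁻ x, imhAcceptMass (fwdPathLaw ν₀ κF) (fun ε => Real.exp (-W ε)) x ∂(fwdPathLaw ν₁ κR) + 1 := by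
  haveI := isProbabilityMeasure_fwdPathLaw ν₀ h0 κF
  have hd : Measurable fun ε => ENNReal.ofReal (Real.exp (ΔF - W ε)) :=
    (Real.measurable_exp.comp (measurable_const.sub h.measurable_W)).ennreal_ofReal
  have hmin1 : Measurable fun ε => min (ENNReal.ofReal (Real.exp (ΔF - W ε))) 1 := hd.min measurable_const
  set a : ℝ≥0∞ := ∫⁻ ε, accF ΔF W ε ∂(fwdPathLaw ν₀ κF) with ha
  have ha' : a = ∫⁻ ε, min (ENNReal.ofReal (Real.exp (ΔF - W ε))) 1 ∂(fwdPathLaw ν₀ κF) := by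
    rw [ha, lintegral_accF_eq_min_density]
    exact lintegral_congr fun ε => min_comm _ _
  -- write `2a + … ` as a double integral of `min(d x,1) + min(d y,1)`
  have h2a : 2 * a = ∫⁻ x, ∫⁻ y, (min (ENNReal.ofReal (Real.exp (ΔF - W x))) 1 +
      min (ENNReal.ofReal (Real.exp (ΔF - W y))) 1) ∂(fwdPathLaw ν₀ κF) ∂(fwdPathLaw ν₀ κF) := by
    have hin : ∀ x, ∫⁻ y, (min (ENNReal.ofReal (Real.exp (ΔF - W x))) 1 +
        min (ENNReal.ofReal (Real.exp (ΔF - W y))) 1) ∂(fwdPathLaw ν₀ κF) =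
        min (ENNReal.ofReal (Real.exp (ΔF - W x))) 1 + a := fun x => by
      rw [lintegral_add_right _ hmin1, lintegral_const, measure_univ, mul_one, ha']
    simp_rw [hin]
    rw [lintegral_add_right _ measurable_const, lintegral_const, measure_univ, mul_one, ← ha', two_mul]
  have h1' : ∫⁻ x, imhAcceptMass (fwdPathLaw ν₀ κF) (fun ε => Real.exp (-W ε)) x ∂(fwdPathLaw ν₁ κR) + 1 =
      ∫⁻ x, ∫⁻ y, (min (ENNReal.ofReal (Real.exp (ΔF - W x))) (ENNReal.ofReal (Real.exp (ΔF - W y))) + 1)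
        ∂(fwdPathLaw ν₀ κF) ∂(fwdPathLaw ν₀ κF) := by
    rw [h.imhAcceptance_eq h0 h1 hΔF]
    have hin : ∀ x, ∫⁻ y, (min (ENNReal.ofReal (Real.exp (ΔF - W x))) (ENNReal.ofReal (Real.exp (ΔF - W y)))
        + 1) ∂(fwdPathLaw ν₀ κF) =
        ∫⁻ y, min (ENNReal.ofReal (Real.exp (ΔF - W x))) (ENNReal.ofReal (Real.exp (ΔF - W y)))
          ∂(fwdPathLaw ν₀ κF) + 1 := fun x => by
      rw [lintegral_add_right _ measurable_const, lintegral_const, measure_univ, mul_one]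
    simp_rw [hin]
    rw [lintegral_add_right _ measurable_const, lintegral_const, measure_univ, mul_one]
  rw [h2a, h1']
  exact lintegral_mono fun x => lintegral_mono fun y => min_one_add_min_one_le _ _

end CrooksPair

end Summit.Ventures.LatticeQCDFlow.Exactness.GeneralNCMC
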